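/-
Copyright (c) 2026 the pub-hodgecm-mathlib formalisation cell (harness21).  Prover seat hodgecm-mathlib-K2Liu-p01 (g5): Track B «K2-LIT»,
#184♮ = hLiu418 = stmt-HodgeConjecture-24832, road `K2_Liu`, socket #41, ROAD Φ organ Φ8a (B) «modulus of `P_Δ(F_v)` on `N_Δ(F_v)`», brick 2.
-/
import Summits.HodgeConjecture.HodgeConjecture.Theorems.K2LiuLocalIntertwiningProperty   -- ★ Φ8a (A): `isLocalSiegelSection_localIntertwining_of_modulus`, Levi algebra
import Summits.HodgeConjecture.HodgeConjecture.Theorems.K2LiuLocalMatrixHaarChar          -- ★ Φ8a (B) brick 1: `addEquivAddHaarChar_matrix_mulLeft∕_mulRight`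
import Literature.NumberTheory.GelbartRogawski1991.LocalDoubledUnitaryBigCellValue         -- ★ `conjLocal_conjLocal'`, `gramS_map_conj`, `gramS_transpose`
import HarnessLib

/-!
# Crux `HLiu418`, road `K2_Liu`, socket #41, organ Φ8a (B) brick 2: THE MODULE OF `t ↦ A t D⁻¹` ON `Skew_{T₀}(E ⊗ F_v)` IS `|det A|_v^{n}`
# (the «square root» `Skew ⊕ δ·Skew = M_n(E ⊗ F_v)`)

Cell `hodgecm-mathlib`, crux item hLiu418 = `stmt-HodgeConjecture-24832`; squad K2 ∕ K2Liu; prover K2Liu-p01 (g5).  THEOREMS ONLY (no `def`,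
no `instance`, no notation, no named-fact hypothesis, no `sorry`); lane `--supports stmt-HodgeConjecture-24832` (count-neutral helper).
Consumer: brick 3 `K2LiuUnipDeltaConjugationModulus` (Haar transport `N_Δ(F_v) ≃ₜ Skew`, the modulus `|det_Δ q|_v^{n}` of `Ad(q)` on `N_Δ(F_v)`, and the
unconditional local intertwining property).

THE MATHEMATICS ([WeilBNT1967, Ch. I §2]; [HarrisKudlaSweet1996, §1 (1.11)–(1.12)]).  `R = E ⊗ F_v = Π_{w ∣ v} E_w`, `σ = c ⊗ 1`, `T = T₀ ⊗ 1`;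
`Skew = {t ∈ M_n(R) : σ(t)ᵀ T + T t = 0}` (the coordinate space of `N_Δ(F_v)`, ★ `nElem`, ★ `K2LiuUnipDeltaLocalCoordinates`); for `q ∈ P_Δ(F_v)` with adapted
blocks `A, D`, `Ad(q)` acts on it by `t ↦ A t D⁻¹` (★ `blkB_matA_conj_nElem`).
* §1 the involution `ι X = −T⁻¹ σ(X)ᵀ T` of `M_n(R)` (`Skew = {ι = id}`; `ι(a X) = σ(a) ι X`, `ι² = id` by ★ `conjLocal_conjLocal'`, `σ(T) = T = Tᵀ`) and the «SQUARE ROOT»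
  decomposition `(s₁, s₂) ↦ s₁ + δ s₂ : Skew × Skew ≃ₜ+ M_n(R)` (`σ(δ) = −δ`; inverse `X ↦ (½(X + ιX), ½δ⁻¹(X − ιX))`), for ANY additive subgroup `S`
  with `S = Skew` as a set (`hS`) — no new definition.
* §2 **`addEquivAddHaarChar_skew_conj`: `χ(t ↦ A t D⁻¹ on Skew) = |det A|_v^{n} = |det_Δ q|_v^{n}`**, `|x|_v = Π_w ‖x_w‖_w`: the decomposition intertwines
  `(L, L)` with `X ↦ A X D⁻¹` on `M_n(R)`, so by ★ `K2E5HaarCharProduct.addEquivAddHaarChar_eq_mul_of_prod` and ★ brick 1 `K2LiuLocalMatrixHaarChar`,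
  `χ(L)² = |det A|_v^{n}·|det D⁻¹|_v^{n}`, while `σ(det A)·det D = 1` (★ `map_det_blkA_mul_det_blkD`) and the isometry `E_{c⁻¹w} → E_w`
  (★ `norm_galAdicCompletionMap`) give `|det D⁻¹|_v = |det A|_v`.
HONEST LABEL.  Count-neutral helper; it retires nothing by itself: `HC_CM` is proved only modulo the 7 printed citations (2 remaining named inputs:
hLiu418 = `stmt-HodgeConjecture-24832`, h413 = `stmt-HodgeConjecture-24833`) until rung 0 closes.

## References
* [WeilBNT1967] A. Weil, *Basic Number Theory* (1967): Ch. I §2 (module of an automorphism; Prop. 2 Cor. 3; products).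
* [HarrisKudlaSweet1996] M. Harris, S. Kudla, W. J. Sweet, J. AMS 9 (1996): §1 (1.11)–(1.15) (`P_Δ = M_Δ N_Δ`, `N_Δ ≅ Herm_n`), §6 (6.14).
-/

set_option autoImplicit false
set_option linter.dupNamespace false -- the mandated namespace repeats `HodgeConjecture.HodgeConjecture`

noncomputable section

open NumberField IsDedekindDomain Matrix MeasureTheory MeasureTheory.Measure Topology
open scoped NNReal ENNReal
open Literature.NumberTheory.GaloisRepresentations.IsNonarchimedeanLocalField
open Literature.NumberTheory.Automorphic Literature.NumberTheory.Automorphic.UnitaryGroup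
open Literature.NumberTheory.GelbartRogawski1991.AdaptedBlocks
open Literature.NumberTheory.GelbartRogawski1991.UnitaryDualPair.LocalSplitting
open Literature.NumberTheory.K2Lit.LocalSiegelDoubled
open Literature.MeasureTheory.Group
open Summit.HodgeConjecture.HodgeConjecture.Cruxes.H413.K2E5HaarCharProduct
open Summit.HodgeConjecture.HodgeConjecture.Cruxes.HLiu418.K2LiuSiegelLeviWeylAlgebra
open Summit.HodgeConjecture.HodgeConjecture.Cruxes.HLiu418.K2LiuUnipDeltaLocalCoordinates
open Summit.HodgeConjecture.HodgeConjecture.Cruxes.HLiu418.K2LiuLocalSiegel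
open Summit.HodgeConjecture.HodgeConjecture.Cruxes.HLiu418.K2LiuLocalIntertwiningProperty
open Summit.HodgeConjecture.HodgeConjecture.Cruxes.HLiu418.K2LiuLocalMatrixHaarChar

namespace Summit.HodgeConjecture.HodgeConjecture.Cruxes.HLiu418.K2LiuSkewConjugationHaarChar

variable (F : Type) [Field F] [NumberField F] (E : Type) [Field E] [NumberField E] [Algebra F E]
  [Algebra.IsQuadraticExtension F E] (c : E ≃ₐ[F] E)
  {δ : E} (hcδ : c δ = -δ) (hδ : δ ≠ 0) {d : F} (hd : δ * δ = algebraMap F E d)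
  (v : HeightOneSpectrum (𝓞 F)) (n : ℕ) {T₀ : Matrix (Fin n) (Fin n) F} (hT₀ : T₀.IsSymm) (hT₀d : IsUnit T₀.det)
  {JD : Matrix (Fin (n + n)) (Fin (n + n)) E} (hJD : JD = (gramD F n T₀).map (algebraMap F E))

/-! ## §1 The involution `ι X = −T⁻¹ σ(X)ᵀ T` of `M_n(E ⊗ F_v)` and the decomposition `Skew ⊕ δ·Skew = M_n` -/

omit [Algebra.IsQuadraticExtension F E] in
include hT₀ in
/-- `T⁻¹` is symmetric (`T = T₀ ⊗ 1` symmetric invertible). [cite: HarrisKudlaSweet1996, §1 (1.9)] -/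
theorem transpose_inv_gramS : ((gramS F E v n T₀)⁻¹)ᵀ = (gramS F E v n T₀)⁻¹ := by
  rw [Matrix.transpose_nonsing_inv, gramS_transpose F E v n hT₀]

omit [Algebra.IsQuadraticExtension F E] in
include hT₀d in
/-- `σ(T⁻¹) = T⁻¹` (`T` has entries in `F`). [cite: HarrisKudlaSweet1996, §1 (1.9)] -/
theorem map_inv_gramS : ((gramS F E v n T₀)⁻¹).map (conjLocal E c v) = (gramS F E v n T₀)⁻¹ := by
  have hT := isUnit_det_gramS' F E v n hT₀d
  refine (Matrix.inv_eq_left_inv ?_).symm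
  calc ((gramS F E v n T₀)⁻¹).map (conjLocal E c v) * gramS F E v n T₀
      = ((gramS F E v n T₀)⁻¹).map (conjLocal E c v) * (gramS F E v n T₀).map (conjLocal E c v) := by rw [gramS_map_conj]
    _ = 1 := by rw [← Matrix.map_mul, Matrix.nonsing_inv_mul _ hT, Matrix.map_one _ (map_zero _) (map_one _)]

include hcδ hδ hd in
/-- `σ(σ(X)) = X` on matrices over `E ⊗ F_v` (★ `conjLocal_conjLocal'`). [cite: HarrisKudlaSweet1996, §1 (1.11)] -/
theorem map_conjLocal_map_conjLocal {ι κ : Type*} (X : Matrix ι κ (LocalRing E v)) :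
    (X.map (conjLocal E c v)).map (conjLocal E c v) = X :=
  Matrix.ext fun i j => conjLocal_conjLocal' F E c hcδ hδ hd v (X i j)

omit [Algebra.IsQuadraticExtension F E] in
/-- `ι(X + Y) = ι X + ι Y`. [folklore] -/
theorem iota_add (X Y : Matrix (Fin n) (Fin n) (LocalRing E v)) :
    -((gramS F E v n T₀)⁻¹ * ((X + Y).map (conjLocal E c v))ᵀ * gramS F E v n T₀) =
      -((gramS F E v n T₀)⁻¹ * (X.map (conjLocal E c v))ᵀ * gramS F E v n T₀) +
        -((gramS F E v n T₀)⁻¹ * (Y.map (conjLocal E c v))ᵀ * gramS F E v n T₀) := by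
  rw [Matrix.map_add _ (map_add _), Matrix.transpose_add, Matrix.mul_add, Matrix.add_mul, neg_add]

omit [Algebra.IsQuadraticExtension F E] in
/-- `ι(a X) = σ(a) ι X` for a scalar `a ∈ E ⊗ F_v`. [folklore] -/
theorem iota_smul (a : LocalRing E v) (X : Matrix (Fin n) (Fin n) (LocalRing E v)) :
    -((gramS F E v n T₀)⁻¹ * ((a • X).map (conjLocal E c v))ᵀ * gramS F E v n T₀) =
      conjLocal E c v a • -((gramS F E v n T₀)⁻¹ * (X.map (conjLocal E c v))ᵀ * gramS F E v n T₀) := by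
  have h : (a • X).map (conjLocal E c v) = conjLocal E c v a • X.map (conjLocal E c v) := by
    ext i j
    simp only [Matrix.map_apply, Matrix.smul_apply, smul_eq_mul, map_mul]
  rw [h, Matrix.transpose_smul, Matrix.mul_smul, Matrix.smul_mul, smul_neg]

include hcδ hδ hd hT₀ hT₀d in
/-- **`ι(ι X) = X`** (`σ² = 1`, `σ(T) = T = Tᵀ`). [cite: HarrisKudlaSweet1996, §1 (1.11)] -/
theorem iota_iota (X : Matrix (Fin n) (Fin n) (LocalRing E v)) :
    -((gramS F E v n T₀)⁻¹ * ((-((gramS F E v n T₀)⁻¹ * (X.map (conjLocal E c v))ᵀ * gramS F E v n T₀)).map (conjLocal E c v))ᵀ *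
        gramS F E v n T₀) = X := by
  have hT := isUnit_det_gramS' F E v n hT₀d
  rw [Matrix.map_neg _ (map_neg _), Matrix.transpose_neg, Matrix.mul_neg, Matrix.neg_mul, neg_neg, Matrix.map_mul, Matrix.map_mul,
    map_inv_gramS F E c v n hT₀d, gramS_map_conj F E c v n (T₀ := T₀), Matrix.transpose_map, map_conjLocal_map_conjLocal F E c hcδ hδ hd v,
    Matrix.transpose_mul, Matrix.transpose_mul, Matrix.transpose_transpose, gramS_transpose F E v n hT₀, transpose_inv_gramS F E v n hT₀]
  rw [show (gramS F E v n T₀)⁻¹ * (gramS F E v n T₀ * (X * (gramS F E v n T₀)⁻¹)) * gramS F E v n T₀ = X by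
    rw [← Matrix.mul_assoc, Matrix.nonsing_inv_mul _ hT, Matrix.one_mul, Matrix.mul_assoc, Matrix.nonsing_inv_mul _ hT, Matrix.mul_one]]

omit [Algebra.IsQuadraticExtension F E] in
include hT₀d in
/-- **`t` is `T₀`-skew iff `ι t = t`** (`σ(t)ᵀ T + T t = 0 ⟺ t = −T⁻¹ σ(t)ᵀ T`). [cite: HarrisKudlaSweet1996, §1 (1.12)] -/
theorem skew_iff_iota_eq (t : Matrix (Fin n) (Fin n) (LocalRing E v)) :
    (t.map (conjLocal E c v))ᵀ * gramS F E v n T₀ + gramS F E v n T₀ * t = 0 ↔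
      -((gramS F E v n T₀)⁻¹ * (t.map (conjLocal E c v))ᵀ * gramS F E v n T₀) = t := by
  have hT := isUnit_det_gramS' F E v n hT₀d
  constructor
  · intro h
    have h' : gramS F E v n T₀ * t = -((t.map (conjLocal E c v))ᵀ * gramS F E v n T₀) := eq_neg_of_add_eq_zero_right h
    have h'' := congrArg ((gramS F E v n T₀)⁻¹ * ·) h'
    simp only [← Matrix.mul_assoc, Matrix.nonsing_inv_mul _ hT, Matrix.one_mul, Matrix.mul_neg] at h''
    exact h''.symm
  · intro h
    have h' := congrArg (gramS F E v n T₀ * ·) h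
    rw [Matrix.mul_neg, ← Matrix.mul_assoc, ← Matrix.mul_assoc, Matrix.mul_nonsing_inv _ hT, Matrix.one_mul] at h'
    rw [← h', add_neg_cancel]

include hcδ hδ hd hT₀ hT₀d in
/-- **THE «SQUARE ROOT» DECOMPOSITION `Skew ⊕ δ·Skew = M_n(E ⊗ F_v)`**: for any additive subgroup `S` of `M_n(E ⊗ F_v)` whose elements are exactly the
`T₀`-skew matrices, `(s₁, s₂) ↦ s₁ + δ s₂` is a bi-continuous additive isomorphism `S × S ≃ M_n(E ⊗ F_v)` (inverse `X ↦ (½(X + ιX), ½δ⁻¹(X − ιX))`,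
`ι X = −T⁻¹ σ(X)ᵀ T`, `σ(δ) = −δ`). [cite: WeilBNT1967, Ch. I §2] [cite: HarrisKudlaSweet1996, §1 (1.11)–(1.12)] -/
theorem exists_continuousAddEquiv_skew_prod (S : AddSubgroup (Matrix (Fin n) (Fin n) (LocalRing E v)))
    (hS : ∀ t, t ∈ S ↔ (t.map (conjLocal E c v))ᵀ * gramS F E v n T₀ + gramS F E v n T₀ * t = 0) :
    ∃ Φ : (S × S) ≃ₜ+ Matrix (Fin n) (Fin n) (LocalRing E v),
      ∀ p : S × S, Φ p = (p.1 : S).1 +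
        algebraMap E (LocalRing E v) δ • (p.2 : S).1 := by
  -- scalars: `δ`, `δ⁻¹`, `½` in `R = E ⊗ F_v` and their behaviour under `σ`
  set δR : LocalRing E v := algebraMap E (LocalRing E v) δ with hδR
  obtain ⟨δu, hδu⟩ : IsUnit δR := (IsUnit.mk0 δ hδ).map _
  obtain ⟨u2, hu2⟩ : IsUnit (2 : LocalRing E v) := isUnit_of_invertible 2
  set dinv : LocalRing E v := ↑δu⁻¹ with hdinv
  set e2 : LocalRing E v := ↑u2⁻¹ with he2
  have hδd : δR * dinv = 1 := by rw [← hδu, hdinv, Units.mul_inv]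
  have h2e : (2 : LocalRing E v) * e2 = 1 := by rw [← hu2, he2, Units.mul_inv]
  have hσδ : conjLocal E c v δR = -δR := by rw [hδR, conjLocal_algebraMap, hcδ, map_neg]
  have hσe : conjLocal E c v e2 = e2 := by
    have h : (2 : LocalRing E v) * conjLocal E c v e2 = 1 := by
      have h' := congrArg (conjLocal E c v) h2e
      rwa [map_mul, map_ofNat, map_one] at h'
    calc conjLocal E c v e2 = e2 * ((2 : LocalRing E v) * conjLocal E c v e2) := by rw [← mul_assoc, mul_comm e2, h2e, one_mul]
      _ = e2 := by rw [h, mul_one]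
  have hσd : conjLocal E c v dinv = -dinv := by
    have h : conjLocal E c v dinv * -δR = 1 := by
      rw [← hσδ, ← map_mul, mul_comm, hδd, map_one]
    calc conjLocal E c v dinv = conjLocal E c v dinv * -δR * -dinv := by rw [mul_assoc, neg_mul_neg, hδd, mul_one]
      _ = -dinv := by rw [h, one_mul]
  -- the involution `ι` and the membership criterion
  set ι : Matrix (Fin n) (Fin n) (LocalRing E v) → Matrix (Fin n) (Fin n) (LocalRing E v) :=
    fun X => -((gramS F E v n T₀)⁻¹ * (X.map (conjLocal E c v))ᵀ * gramS F E v n T₀) with hι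
  have hιadd : ∀ X Y, ι (X + Y) = ι X + ι Y := fun X Y => iota_add F E c v n X Y
  have hιsmul : ∀ (a : LocalRing E v) X, ι (a • X) = conjLocal E c v a • ι X := fun a X => iota_smul F E c v n a X
  have hιι : ∀ X, ι (ι X) = X := fun X => iota_iota F E c hcδ hδ hd v n hT₀ hT₀d X
  have hιneg : ∀ X, ι (-X) = -ι X := fun X => by rw [← neg_one_smul (LocalRing E v) X, hιsmul, map_neg, map_one, neg_one_smul]
  have hιsub : ∀ X Y, ι (X - Y) = ι X - ι Y := fun X Y => by rw [sub_eq_add_neg, hιadd, hιneg, ← sub_eq_add_neg]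
  have hmem : ∀ t, t ∈ S ↔ ι t = t := fun t => (hS t).trans (skew_iff_iota_eq F E c v n hT₀d t)
  have hιc : Continuous ι :=
    ((continuous_const.matrix_mul ((continuous_id.matrix_map (continuous_conjLocal E c v)).matrix_transpose)).matrix_mul
      continuous_const).neg
  -- the projections `P X = ½(X + ιX) ∈ S`, `Q X = ½δ⁻¹(X − ιX) ∈ S`
  have hP : ∀ X, e2 • (X + ι X) ∈ S := fun X => by
    rw [hmem, hιsmul, hσe, hιadd, hιι, add_comm (ι X) X]
  have hQ : ∀ X, (e2 * dinv) • (X - ι X) ∈ S := fun X => by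
    rw [hmem, hιsmul, map_mul, hσe, hσd, hιsub, hιι, mul_neg, neg_smul, ← smul_neg, neg_sub]
  refine ⟨⟨⟨⟨fun p => (p.1 : S).1 + δR • (p.2 : S).1,
      fun X => (⟨e2 • (X + ι X), hP X⟩, ⟨(e2 * dinv) • (X - ι X), hQ X⟩), fun p => ?_, fun X => ?_⟩, fun p q => ?_⟩, ?_, ?_⟩, fun p => rfl⟩
  · -- left inverse: `P(s₁ + δ s₂) = s₁`, `Q(s₁ + δ s₂) = s₂`
    obtain ⟨⟨s₁, hs₁⟩, ⟨s₂, hs₂⟩⟩ := p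
    have h1 : ι s₁ = s₁ := (hmem s₁).1 hs₁
    have h2 : ι s₂ = s₂ := (hmem s₂).1 hs₂
    have hιs : ι (s₁ + δR • s₂) = s₁ - δR • s₂ := by rw [hιadd, hιsmul, h1, h2, hσδ, neg_smul, sub_eq_add_neg]
    refine Prod.ext (Subtype.ext ?_) (Subtype.ext ?_)
    · show e2 • (s₁ + δR • s₂ + ι (s₁ + δR • s₂)) = s₁
      rw [hιs, show s₁ + δR • s₂ + (s₁ - δR • s₂) = (2 : LocalRing E v) • s₁ by rw [two_smul]; abel, smul_smul, mul_comm, h2e, one_smul]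
    · show (e2 * dinv) • (s₁ + δR • s₂ - ι (s₁ + δR • s₂)) = s₂
      rw [hιs, show s₁ + δR • s₂ - (s₁ - δR • s₂) = ((2 : LocalRing E v) * δR) • s₂ by rw [mul_smul, two_smul]; abel, smul_smul,
        show e2 * dinv * (2 * δR) = (2 * e2) * (δR * dinv) by ring, h2e, hδd, one_mul, one_smul]
  · -- right inverse: `P X + δ Q X = X`
    show e2 • (X + ι X) + δR • ((e2 * dinv) • (X - ι X)) = X
    rw [smul_smul, show δR * (e2 * dinv) = e2 * (δR * dinv) by ring, hδd, mul_one, ← smul_add,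
      show X + ι X + (X - ι X) = (2 : LocalRing E v) • X by rw [two_smul]; abel, smul_smul, mul_comm, h2e, one_smul]
  · -- additivity
    show ((p + q).1 : S).1 + δR • ((p + q).2 : S).1 =
      (p.1 : S).1 + δR • (p.2 : S).1 +
        ((q.1 : S).1 + δR • (q.2 : S).1)
    rw [Prod.fst_add, Prod.snd_add, AddSubgroup.coe_add, AddSubgroup.coe_add, smul_add]
    abel
  · -- continuity of `Φ`
    exact (continuous_subtype_val.comp continuous_fst).add ((continuous_subtype_val.comp continuous_snd).const_smul δR)
  · -- continuity of `Φ⁻¹`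
    exact ((((continuous_id.add hιc).const_smul e2).subtype_mk _).prodMk (((continuous_id.sub hιc).const_smul (e2 * dinv)).subtype_mk _))

/-! ## §2 `χ(t ↦ A t D⁻¹ on Skew) = |det A|_v^{n}` -/

omit [Algebra.IsQuadraticExtension F E] in
/-- `M_n(E ⊗ F_v)` is second countable (`E_w` is, ★ `secondCountableTopology_localField`). [folklore] -/
theorem secondCountableTopology_matrix_localRing : SecondCountableTopology (Matrix (Fin n) (Fin n) (LocalRing E v)) := by
  haveI : ∀ w : PlacesOver E v, SecondCountableTopology (w.1.adicCompletion E) := fun w => secondCountableTopology_localField _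
  exact inferInstanceAs (SecondCountableTopology (Fin n → Fin n → LocalRing E v))

omit [Algebra.IsQuadraticExtension F E] in
/-- `M_n(E ⊗ F_v)` is locally compact. [folklore] -/
theorem locallyCompactSpace_matrix_localRing : LocallyCompactSpace (Matrix (Fin n) (Fin n) (LocalRing E v)) :=
  inferInstanceAs (LocallyCompactSpace (Fin n → Fin n → LocalRing E v))

omit [Algebra.IsQuadraticExtension F E] in
/-- `Skew` is closed in `M_n(E ⊗ F_v)` (a level set of a continuous map). [folklore] -/
theorem isClosed_skew (S : AddSubgroup (Matrix (Fin n) (Fin n) (LocalRing E v)))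
    (hS : ∀ t, t ∈ S ↔ (t.map (conjLocal E c v))ᵀ * gramS F E v n T₀ + gramS F E v n T₀ * t = 0) :
    IsClosed (S : Set (Matrix (Fin n) (Fin n) (LocalRing E v))) := by
  have h : (S : Set (Matrix (Fin n) (Fin n) (LocalRing E v))) =
      (fun t : Matrix (Fin n) (Fin n) (LocalRing E v) => (t.map (conjLocal E c v))ᵀ * gramS F E v n T₀ + gramS F E v n T₀ * t) ⁻¹' {0} :=
    Set.ext fun t => hS t
  rw [h]
  exact isClosed_singleton.preimage ((((continuous_id.matrix_map (continuous_conjLocal E c v)).matrix_transpose).matrix_mul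
    continuous_const).add (continuous_const.matrix_mul continuous_id))

omit [NumberField F] [Algebra.IsQuadraticExtension F E] in
/-- `normAbs` on `E_w` is Mathlib's `‖·‖₊` (both are `q_w^{-w(x)}`; the tree's `norm_eq_coe_normAbs`, re-derived as in ★ `K2E5QuatLocalLeftMulModule`). [folklore] -/
theorem normAbs_eq_nnnorm (w : PlacesOver E v) (x : w.1.adicCompletion E) : normAbs (w.1.adicCompletion E) x = ‖x‖₊ := by
  apply NNReal.coe_injective
  rw [coe_nnnorm]
  by_cases hx : x = 0
  · rw [hx, norm_zero, map_zero, NNReal.coe_zero]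
  have hv : Valued.v x ≠ 0 := (Valuation.ne_zero_iff _).2 hx
  have hxn : Valued.v x = WithZero.exp (Multiplicative.toAdd (WithZero.unzero hv)) := by
    rw [WithZero.exp, ofAdd_toAdd, WithZero.coe_unzero]
  rw [FinitePlace.norm_def, WithZeroMulInt.toNNReal_neg_apply _ hv,
    normAbs_eq_inv_zpow_of_valued_eq w.1 hxn, residueFieldCard_adicCompletion_eq, _root_.inv_zpow', neg_neg]
  rfl

omit [Algebra.IsQuadraticExtension F E] in
include hJD hT₀d in
/-- **`|det D⁻¹|_v = |det A|_v` on `P_Δ(F_v)`**, factorwise after re-indexing: `det D⁻¹ = σ(det A)` (★ `map_det_blkA_mul_det_blkD`) and `c_w : E_{c⁻¹w} → E_w`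
is an isometry (★ `norm_galAdicCompletionMap`). [cite: HarrisKudlaSweet1996, §1 (1.12), (1.15)] -/
theorem prod_normAbs_det_blkD_inv {q : UnitaryGroup.localPi E c (n + n) JD v} (hC : blkC (matA F E c v n q) = 0) :
    ∏ w : PlacesOver E v, normAbs (w.1.adicCompletion E) (((blkD (matA F E c v n q))⁻¹).det w) =
      ∏ w : PlacesOver E v, normAbs (w.1.adicCompletion E) ((blkA (matA F E c v n q)).det w) := by
  obtain ⟨-, hDu⟩ := isUnit_det_blkA_blkD F E c v n hC
  have hrel := map_det_blkA_mul_det_blkD F E c v n hT₀d hJD hC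
  have hinv : ((blkD (matA F E c v n q))⁻¹).det = conjLocal E c v (blkA (matA F E c v n q)).det := by
    obtain ⟨u, hu⟩ := hDu
    rw [Matrix.det_nonsing_inv, ← hu, Ring.inverse_unit]
    exact Units.inv_eq_of_mul_eq_one_left (by rw [hu]; exact hrel)
  rw [hinv]
  simp_rw [normAbs_eq_nnnorm]
  have hw : ∀ w : PlacesOver E v, ‖conjLocal E c v (blkA (matA F E c v n q)).det w‖₊ =
      ‖(blkA (matA F E c v n q)).det ⟨c⁻¹ • w.1, under_inv_smul_eq c w⟩‖₊ := fun w => by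
    apply NNReal.coe_injective
    rw [coe_nnnorm, coe_nnnorm, conjLocal_apply, norm_galAdicCompletionMap]
  simp_rw [hw]
  exact prod_invSmulPlace F E c v (fun w => ‖(blkA (matA F E c v n q)).det w‖₊)

include hcδ hδ hd hT₀ hT₀d hJD in
/-- **THE MODULE OF `Ad(q)` ON `Skew`: `χ(t ↦ A t D⁻¹) = |det A|_v^{n} = |det_Δ q|_v^{n}`** for `q ∈ P_Δ(F_v)` with adapted blocks `A`, `D`, and any bi-continuous additive
automorphism `L` of `S = Skew` acting as `t ↦ A t D⁻¹`.  «Square root»: `(s₁, s₂) ↦ s₁ + δ s₂` intertwines `(L, L)` on `S × S` with `X ↦ A X D⁻¹` on `M_n(E ⊗ F_v)`,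
so `χ(L)² = |det A|_v^{n}·|det D⁻¹|_v^{n}` (★ `addEquivAddHaarChar_eq_mul_of_prod`, ★ `addEquivAddHaarChar_eq_of_semiconj`, ★ brick 1), and `|det D⁻¹|_v = |det A|_v`.
[cite: WeilBNT1967, Ch. I §2, Prop. 2 Cor. 3] [cite: HarrisKudlaSweet1996, §1 (1.12), (1.15)] -/
theorem addEquivAddHaarChar_skew_conj (S : AddSubgroup (Matrix (Fin n) (Fin n) (LocalRing E v)))
    (hS : ∀ t, t ∈ S ↔ (t.map (conjLocal E c v))ᵀ * gramS F E v n T₀ + gramS F E v n T₀ * t = 0)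
    [MeasurableSpace S] [BorelSpace S] [LocallyCompactSpace S]
    {q : UnitaryGroup.localPi E c (n + n) JD v} (hq : IsSiegelDelta F E c hcδ hδ hd v n hT₀ hJD q) (L : S ≃ₜ+ S)
    (hL : ∀ s : S, (L s).1 = blkA (matA F E c v n q) * s.1 * (blkD (matA F E c v n q))⁻¹) :
    ((addEquivAddHaarChar L : ℝ≥0) : ℝ) = absDetDelta F E c v n q ^ n := by
  -- topology and Borel structures
  haveI : SecondCountableTopology (Matrix (Fin n) (Fin n) (LocalRing E v)) := secondCountableTopology_matrix_localRing F E v n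
  haveI : LocallyCompactSpace (Matrix (Fin n) (Fin n) (LocalRing E v)) := locallyCompactSpace_matrix_localRing F E v n
  letI : MeasurableSpace (Matrix (Fin n) (Fin n) (LocalRing E v)) := borel _
  haveI : BorelSpace (Matrix (Fin n) (Fin n) (LocalRing E v)) := ⟨rfl⟩
  haveI : SecondCountableTopology S := TopologicalSpace.Subtype.secondCountableTopology _
  -- the Levi blocks
  have hC := (isSiegelDelta_iff_blkC_eq_zero F E c hcδ hδ hd v n hT₀ hJD q).1 hq
  obtain ⟨hAu, hDu⟩ := isUnit_det_blkA_blkD F E c v n hC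
  set A := blkA (matA F E c v n q) with hA
  set D := blkD (matA F E c v n q) with hD
  have hDinv : IsUnit (D⁻¹).det := Matrix.isUnit_nonsing_inv_det D hDu
  -- the maps on `M_n`, the decomposition, and `(L, L)` on `S × S`
  obtain ⟨LA, hLA⟩ := exists_continuousAddEquiv_mulLeft A hAu
  obtain ⟨RD, hRD⟩ := exists_continuousAddEquiv_mulRight D⁻¹ hDinv
  obtain ⟨Φ, hΦ⟩ := exists_continuousAddEquiv_skew_prod F E c hcδ hδ hd v n hT₀ hT₀d S hS
  set LL : (S × S) ≃ₜ+ (S × S) :=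
    ⟨⟨⟨fun p => (L p.1, L p.2), fun p => (L.symm p.1, L.symm p.2), fun p => Prod.ext (L.symm_apply_apply p.1) (L.symm_apply_apply p.2),
      fun p => Prod.ext (L.apply_symm_apply p.1) (L.apply_symm_apply p.2)⟩, fun p p' => Prod.ext (map_add L p.1 p'.1) (map_add L p.2 p'.2)⟩,
      ((map_continuous L).comp continuous_fst).prodMk ((map_continuous L).comp continuous_snd),
      ((map_continuous L.symm).comp continuous_fst).prodMk ((map_continuous L.symm).comp continuous_snd)⟩ with hLL
  have h1 : addEquivAddHaarChar LL = addEquivAddHaarChar L * addEquivAddHaarChar L :=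
    addEquivAddHaarChar_eq_mul_of_prod LL L L fun p => rfl
  have h2 : addEquivAddHaarChar LL = addEquivAddHaarChar (RD.trans LA) :=
    addEquivAddHaarChar_eq_of_semiconj Φ LL (RD.trans LA) fun p => by
      show Φ (L p.1, L p.2) = LA (RD (Φ p))
      rw [hΦ, hΦ, hLA, hRD, hL, hL, Matrix.add_mul, Matrix.mul_add, Matrix.smul_mul, Matrix.mul_smul, Matrix.mul_assoc, Matrix.mul_assoc]
  have h3 : addEquivAddHaarChar (RD.trans LA) =
      ((∏ w : PlacesOver E v, normAbs (w.1.adicCompletion E) (A.det w)) ^ n) ^ 2 := by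
    rw [addEquivAddHaarChar_trans, addEquivAddHaarChar_matrix_mulLeft E v A hAu LA hLA, addEquivAddHaarChar_matrix_mulRight E v D⁻¹ hDinv RD hRD,
      Fintype.card_fin, hA, hD, prod_normAbs_det_blkD_inv F E c v n hT₀d hJD hC, sq]
  have h4 : addEquivAddHaarChar L = (∏ w : PlacesOver E v, normAbs (w.1.adicCompletion E) (A.det w)) ^ n := by
    rw [← pow_left_inj₀ zero_le zero_le two_ne_zero, sq, ← h1, h2, h3]
  rw [h4, absDetDelta, NNReal.coe_pow, NNReal.coe_prod]
  refine congrArg (· ^ n) (Finset.prod_congr rfl fun w _ => ?_)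
  rw [normAbs_eq_nnnorm, coe_nnnorm, hA, detDelta_levi F E c v n hC]

end Summit.HodgeConjecture.HodgeConjecture.Cruxes.HLiu418.K2LiuSkewConjugationHaarChar

end
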